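import Mathlib
import Summits.ResolutionOfSingularities.ResolutionOfSingularities.Theorems.WeightedInvariantLocalWeightedDropNCGameDecoratedWins
import Summits.ResolutionOfSingularities.ResolutionOfSingularities.Theorems.WeightedInvariantLocalWeightedDropNCResSettingDefs

/-!
# `WeightedInvariant.LocalWeightedDrop` ENGINE, W′|₄ line (R₂ ⊇ the surface programme): B-PERMISSIBLE DECORATED WINNING — `DBWinsTo`

Sub-problem `ResolutionOfSingularities`, ENGINE crux `stmt-ResolutionOfSingularities-8899` (`LocalWeightedDrop`), line hasse-ridge-face-selection, registered
stub W′|₄ `stub_wildWideApexFourStartsWon`; res-L1-w43-strat-1 STRATEGY-CENSUS §14.7 (the x₀-lift of the m = 2 NC-resolution engine into the wild (2,2) corner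
needs the engine's moves B-PERMISSIBLE and its successors the decorated TRANSFORMS, both of which `DWinsTo` hides in an `∃`); res-L1-w43-plan-1 RULING
2026-08-27T21:45:42Z (D₃ᴮ lane, object (1)).  [OURS · L1 W4.3 · chain w43 · res-L1-w43-lead-1 g6; «[OURS · L1 W4.3] replaces the role of nothing printed;
NOT a statement of the manuscript»; AI-produced, gate-checked, weaker than expert review.]

The refinement of `TameFourTupleDrop.DWinsTo` (…NCGameDecoratedWins) on decorated states `τ = (b, δ)` (germ, decoration): a region's move from `τ` must be
B-PERMISSIBLE for `τ.2` (`IsBPermissible`, …NCResSettingDefs: permissible, O-permissible, normal crossing with the boundary) and the successor reached at the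
answer `(c, i)` with sliced strict transform `X 0 * slice i G` must be THE TRANSFORM `(X 0 * slice i G, τ.2.transform Φ w c i)` (CJS Def. 3.6/3.15 in the count
game).  Every landed m = 2 regime proof already plays such moves; `DBWinsTo` merely records it.
* `BMoveClause τ Φ w good` — the move clause with the goodness predicate on the decorated transform;
* `DBRankedRegion Q T ρ`, `DBWinsTo Q σ`, `DBWinsToBy Q α σ` — regions / winning / values;
* calculus: `BMoveClause.mono/.moveClause`, `DBWinsTo.dWinsTo` (forget), `of_target`, `mono`, `exists_move`, **`of_measure`**, **`bind`**, **`wf_induction`**.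
-/

set_option linter.dupNamespace false -- mandated namespace of this single-conjunct summit

noncomputable section

namespace Summit.ResolutionOfSingularities.ResolutionOfSingularities.Theorems

namespace TameFourTupleDrop

open MvPowerSeries Literature.AlgebraicGeometry.Resolution

variable {k : Type} [Field k] {m : ℕ}

/-! ## The B-move clause and B-permissible regions -/

/-- THE B-MOVE CLAUSE from the decorated state `τ = (b, δ)` for the move `(Φ, w)` with goodness predicate `good` on DECORATED states: at every exceptional
point `c ≠ 0` and every factorisation `b∘Φ(chart_{w,c}) = s^A·G`, `s ∤ G`, some live slot `i` has a good TRANSFORM `(s · G|_{y′ᵢ = 0}, δ.transform Φ w c i)`. -/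
def BMoveClause (τ : MvPowerSeries (Fin (m + 1)) k × Decoration k m) (Φ : Fin (m + 1) → MvPowerSeries (Fin (m + 1)) k) (w : Fin (m + 1) → ℕ)
    (good : MvPowerSeries (Fin (m + 1)) k × Decoration k m → Prop) : Prop :=
  ∀ c : Fin (m + 1) → k, (∀ i, w i = 0 → c i = 0) → c ≠ 0 →
    ∀ (A : ℕ) (G : MvPowerSeries (Fin (m + 1 + 1)) k),
      subst (CobordantChart.chart w c) (subst Φ τ.1) = X 0 ^ A * G → ¬ (X (0 : Fin (m + 1 + 1)) ∣ G) →
      ∃ i : Fin (m + 1), c i ≠ 0 ∧ good (X 0 * TupleGame.slice i G, τ.2.transform Φ w c i)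

/-- A B-PERMISSIBLE DECORATED RANKED REGION towards the target `Q`: from every member not in the target some B-PERMISSIBLE move has, at every answer, its
decorated transform inside the region with smaller rank. -/
def DBRankedRegion (Q : MvPowerSeries (Fin (m + 1)) k × Decoration k m → Prop) (T : Set (MvPowerSeries (Fin (m + 1)) k × Decoration k m))
    (ρ : MvPowerSeries (Fin (m + 1)) k × Decoration k m → Ordinal.{0}) : Prop :=
  ∀ τ ∈ T, ¬ Q τ → ∃ (Φ : Fin (m + 1) → MvPowerSeries (Fin (m + 1)) k) (w : Fin (m + 1) → ℕ),
    IsBPermissible τ.2 Φ w ∧ BMoveClause τ Φ w (fun τ' => τ' ∈ T ∧ ρ τ' < ρ τ)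

/-- `DBWinsTo Q σ`: the mover forces `Q` from `σ` by B-permissible moves along decorated transforms. -/
def DBWinsTo (Q : MvPowerSeries (Fin (m + 1)) k × Decoration k m → Prop) (σ : MvPowerSeries (Fin (m + 1)) k × Decoration k m) : Prop :=
  ∃ (T : Set (MvPowerSeries (Fin (m + 1)) k × Decoration k m)) (ρ : MvPowerSeries (Fin (m + 1)) k × Decoration k m → Ordinal.{0}),
    DBRankedRegion Q T ρ ∧ σ ∈ T

/-- The VALUE form of `DBWinsTo`. -/
def DBWinsToBy (Q : MvPowerSeries (Fin (m + 1)) k × Decoration k m → Prop) (α : Ordinal.{0})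
    (σ : MvPowerSeries (Fin (m + 1)) k × Decoration k m) : Prop :=
  ∃ (T : Set (MvPowerSeries (Fin (m + 1)) k × Decoration k m)) (ρ : MvPowerSeries (Fin (m + 1)) k × Decoration k m → Ordinal.{0}),
    DBRankedRegion Q T ρ ∧ σ ∈ T ∧ ρ σ ≤ α

/-! ## Calculus -/

variable {Q : MvPowerSeries (Fin (m + 1)) k × Decoration k m → Prop}

/-- The B-move clause is monotone in the goodness predicate. -/
theorem BMoveClause.mono {τ : MvPowerSeries (Fin (m + 1)) k × Decoration k m} {Φ : Fin (m + 1) → MvPowerSeries (Fin (m + 1)) k}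
    {w : Fin (m + 1) → ℕ} {good good' : MvPowerSeries (Fin (m + 1)) k × Decoration k m → Prop} (h : BMoveClause τ Φ w good)
    (hmono : ∀ τ', good τ' → good' τ') : BMoveClause τ Φ w good' := by
  intro c hc hc0 A G hG hX
  obtain ⟨i, hi, hgood⟩ := h c hc hc0 A G hG hX
  exact ⟨i, hi, hmono _ hgood⟩

/-- Forgetting the decoration of the successor: a B-move clause is a move clause on the germ. -/
theorem BMoveClause.moveClause {τ : MvPowerSeries (Fin (m + 1)) k × Decoration k m} {Φ : Fin (m + 1) → MvPowerSeries (Fin (m + 1)) k}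
    {w : Fin (m + 1) → ℕ} {good : MvPowerSeries (Fin (m + 1)) k × Decoration k m → Prop} (h : BMoveClause τ Φ w good) :
    MoveClause τ.1 Φ w (fun b' => ∃ τ', τ'.1 = b' ∧ good τ') := by
  intro c hc hc0 A G hG hX
  obtain ⟨i, hi, hgood⟩ := h c hc hc0 A G hG hX
  exact ⟨i, hi, _, rfl, hgood⟩

/-- A state has a value iff it is winning. -/
theorem dbWinsTo_iff_exists_by {σ : MvPowerSeries (Fin (m + 1)) k × Decoration k m} : DBWinsTo Q σ ↔ ∃ α, DBWinsToBy Q α σ :=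
  ⟨fun ⟨T, ρ, hT, hσ⟩ => ⟨ρ σ, T, ρ, hT, hσ, le_rfl⟩, fun ⟨_, T, ρ, hT, hσ, _⟩ => ⟨T, ρ, hT, hσ⟩⟩

/-- A target state is winning. -/
theorem DBWinsTo.of_target {σ : MvPowerSeries (Fin (m + 1)) k × Decoration k m} (h : Q σ) : DBWinsTo Q σ :=
  ⟨{σ}, fun _ => 0, fun τ hτ hQ => absurd (by rw [Set.mem_singleton_iff.mp hτ]; exact h) hQ, Set.mem_singleton σ⟩

/-- Monotonicity in the target. -/
theorem DBRankedRegion.mono {Q' : MvPowerSeries (Fin (m + 1)) k × Decoration k m → Prop} (hQ : ∀ τ, Q τ → Q' τ)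
    {T : Set (MvPowerSeries (Fin (m + 1)) k × Decoration k m)} {ρ : MvPowerSeries (Fin (m + 1)) k × Decoration k m → Ordinal.{0}}
    (h : DBRankedRegion Q T ρ) : DBRankedRegion Q' T ρ :=
  fun τ hτ hQ' => h τ hτ fun hq => hQ' (hQ τ hq)

/-- Monotonicity in the target. -/
theorem DBWinsTo.mono {Q' : MvPowerSeries (Fin (m + 1)) k × Decoration k m → Prop} (hQ : ∀ τ, Q τ → Q' τ)
    {σ : MvPowerSeries (Fin (m + 1)) k × Decoration k m} (h : DBWinsTo Q σ) : DBWinsTo Q' σ := by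
  obtain ⟨T, ρ, hT, hσ⟩ := h
  exact ⟨T, ρ, hT.mono hQ, hσ⟩

/-- **FORGET**: B-permissible decorated winning is decorated winning on the germs. -/
theorem DBWinsTo.dWinsTo {σ : MvPowerSeries (Fin (m + 1)) k × Decoration k m} (h : DBWinsTo Q σ) :
    DWinsTo (St := MvPowerSeries (Fin (m + 1)) k × Decoration k m) Prod.fst Q σ := by
  obtain ⟨T, ρ, hT, hσ⟩ := h
  refine ⟨T, ρ, fun τ hτ hQ => ?_, hσ⟩
  obtain ⟨Φ, w, hperm, hcl⟩ := hT τ hτ hQ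
  exact ⟨Φ, w, hperm.1, (hcl.moveClause).mono fun b' ⟨τ', hb', hτ'T, hlt⟩ => ⟨τ', hτ'T, hb', hlt⟩⟩

/-- From a winning non-target state some B-permissible move leads, at every answer, to winning transforms of smaller value. -/
theorem DBWinsToBy.exists_move {α : Ordinal.{0}} {σ : MvPowerSeries (Fin (m + 1)) k × Decoration k m} (h : DBWinsToBy Q α σ) (hQ : ¬ Q σ) :
    ∃ (Φ : Fin (m + 1) → MvPowerSeries (Fin (m + 1)) k) (w : Fin (m + 1) → ℕ),
      IsBPermissible σ.2 Φ w ∧ BMoveClause σ Φ w (fun τ' => ∃ β < α, DBWinsToBy Q β τ') := by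
  obtain ⟨T, ρ, hT, hσ, hρ⟩ := h
  obtain ⟨Φ, w, hmv, hcl⟩ := hT σ hσ hQ
  exact ⟨Φ, w, hmv, hcl.mono fun τ' ⟨hτ', hlt⟩ => ⟨ρ τ', lt_of_lt_of_le hlt hρ, T, ρ, hT, hτ', le_rfl⟩⟩

/-- **MEASURE FORM.**  If on a class `C` of decorated states an ordinal measure `μ` is lowered at every answer of some B-permissible move from every
non-target member — the decorated transforms lying in `C ∪ Q` — then every member of `C` wins towards `Q`. -/
theorem DBWinsTo.of_measure (C : Set (MvPowerSeries (Fin (m + 1)) k × Decoration k m)) (μ : MvPowerSeries (Fin (m + 1)) k × Decoration k m → Ordinal.{0})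
    (hstep : ∀ τ ∈ C, ¬ Q τ → ∃ (Φ : Fin (m + 1) → MvPowerSeries (Fin (m + 1)) k) (w : Fin (m + 1) → ℕ),
      IsBPermissible τ.2 Φ w ∧ BMoveClause τ Φ w (fun τ' => Q τ' ∨ (τ' ∈ C ∧ μ τ' < μ τ)))
    {σ : MvPowerSeries (Fin (m + 1)) k × Decoration k m} (hσ : σ ∈ C) : DBWinsTo Q σ := by
  classical
  refine ⟨C ∪ {τ | Q τ}, fun τ => if Q τ then 0 else μ τ + 1, ?_, Or.inl hσ⟩
  intro τ hτ hQ
  have hτC : τ ∈ C := hτ.resolve_right hQ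
  obtain ⟨Φ, w, hmv, hcl⟩ := hstep τ hτC hQ
  refine ⟨Φ, w, hmv, hcl.mono fun τ' hτ' => ?_⟩
  rcases hτ' with hq | ⟨hC', hlt⟩
  · refine ⟨Or.inr hq, ?_⟩
    show (if Q τ' then (0 : Ordinal.{0}) else μ τ' + 1) < (if Q τ then 0 else μ τ + 1)
    rw [if_pos hq, if_neg hQ]
    exact Order.lt_add_one_iff.mpr bot_le
  · refine ⟨Or.inl hC', ?_⟩
    show (if Q τ' then (0 : Ordinal.{0}) else μ τ' + 1) < (if Q τ then 0 else μ τ + 1)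
    rw [if_neg hQ]
    split_ifs
    · exact Order.lt_add_one_iff.mpr bot_le
    · exact Order.lt_add_one_iff.mpr (Order.add_one_le_of_lt hlt)

/-- **BIND.**  If `σ` B-wins towards `Q`, and every `Q`-state B-wins towards `P`, then `σ` B-wins towards `P`. -/
theorem DBWinsTo.bind {P : MvPowerSeries (Fin (m + 1)) k × Decoration k m → Prop} {σ : MvPowerSeries (Fin (m + 1)) k × Decoration k m}
    (h : DBWinsTo Q σ) (hQP : ∀ τ, Q τ → DBWinsTo P τ) : DBWinsTo P σ := by
  classical
  obtain ⟨T₁, ρ₁, hT₁, hσ⟩ := h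
  let W : Set (MvPowerSeries (Fin (m + 1)) k × Decoration k m) := {τ | DBWinsTo P τ}
  let val : MvPowerSeries (Fin (m + 1)) k × Decoration k m → Ordinal.{0} := fun τ => sInf {α | DBWinsToBy P α τ}
  have hval : ∀ τ ∈ W, DBWinsToBy P (val τ) τ := fun τ hτ => csInf_mem (dbWinsTo_iff_exists_by.mp hτ)
  have hval_le : ∀ {τ α}, DBWinsToBy P α τ → val τ ≤ α := fun h => csInf_le' h
  let vQ : {τ : MvPowerSeries (Fin (m + 1)) k × Decoration k m // τ ∈ T₁ ∧ Q τ} → Ordinal.{0} := fun τ => val τ.1 + 1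
  let Ω : Ordinal.{0} := ⨆ τ, vQ τ
  have hΩ : ∀ τ, τ ∈ T₁ → Q τ → val τ < Ω := fun τ h₁ h₂ =>
    lt_of_lt_of_le (Order.lt_add_one_iff.mpr le_rfl)
      (le_ciSup (Ordinal.bddAbove_of_small (s := Set.range vQ)) (⟨τ, h₁, h₂⟩ : {τ // τ ∈ T₁ ∧ Q τ}))
  let T₁' : Set (MvPowerSeries (Fin (m + 1)) k × Decoration k m) := T₁ ∩ {τ | ¬ Q τ}
  let T : Set (MvPowerSeries (Fin (m + 1)) k × Decoration k m) := W ∪ T₁'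
  let ρ : MvPowerSeries (Fin (m + 1)) k × Decoration k m → Ordinal.{0} := fun τ =>
    if τ ∈ W then (if τ ∈ T₁' then min (val τ) (Ω + ρ₁ τ) else val τ) else Ω + ρ₁ τ
  have hρW : ∀ τ ∈ W, ρ τ ≤ val τ := by
    intro τ hτ
    simp only [ρ, if_pos hτ]
    split_ifs
    · exact min_le_left _ _
    · exact le_rfl
  have hρ1 : ∀ τ ∈ T₁', ρ τ ≤ Ω + ρ₁ τ := by
    intro τ hτ
    simp only [ρ, if_pos hτ]
    split_ifs
    · exact min_le_right _ _
    · exact le_rfl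
  have hcases : ∀ τ ∈ T, (τ ∈ W ∧ ρ τ = val τ) ∨ (τ ∈ T₁' ∧ ρ τ = Ω + ρ₁ τ) := by
    intro τ hτ
    by_cases hW : τ ∈ W
    · by_cases h1 : τ ∈ T₁'
      · simp only [ρ, if_pos hW, if_pos h1]
        rcases le_total (val τ) (Ω + ρ₁ τ) with h | h
        · exact Or.inl ⟨hW, min_eq_left h⟩
        · exact Or.inr ⟨h1, min_eq_right h⟩
      · exact Or.inl ⟨hW, by simp only [ρ, if_pos hW, if_neg h1]⟩
    · exact Or.inr ⟨hτ.resolve_left hW, by simp only [ρ, if_neg hW]⟩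
  refine ⟨T, ρ, ?_, ?_⟩
  · intro τ hτ hP
    rcases hcases τ hτ with ⟨hW, hρτ⟩ | ⟨h1, hρτ⟩
    · obtain ⟨Φ, w, hmv, hcl⟩ := (hval τ hW).exists_move hP
      refine ⟨Φ, w, hmv, hcl.mono fun τ' ⟨β, hβ, hτ'⟩ => ?_⟩
      have hW' : τ' ∈ W := dbWinsTo_iff_exists_by.mpr ⟨β, hτ'⟩
      refine ⟨Or.inl hW', ?_⟩
      rw [hρτ]
      exact lt_of_le_of_lt ((hρW τ' hW').trans (hval_le hτ')) hβ
    · obtain ⟨Φ, w, hmv, hcl⟩ := hT₁ τ h1.1 h1.2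
      refine ⟨Φ, w, hmv, hcl.mono fun τ' ⟨hτ'₁, hlt⟩ => ?_⟩
      rw [hρτ]
      by_cases hQ' : Q τ'
      · have hW' : τ' ∈ W := hQP τ' hQ'
        exact ⟨Or.inl hW', lt_of_le_of_lt (hρW τ' hW') (lt_of_lt_of_le (hΩ τ' hτ'₁ hQ') le_self_add)⟩
      · have h1' : τ' ∈ T₁' := ⟨hτ'₁, hQ'⟩
        exact ⟨Or.inr h1', lt_of_le_of_lt (hρ1 τ' h1') ((add_lt_add_iff_left Ω).mpr hlt)⟩
  · by_cases hQ : Q σ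
    · exact Or.inl (hQP σ hQ)
    · exact Or.inr ⟨hσ, hQ⟩

/-- **WELL-FOUNDED ASSEMBLY.**  If from every state the mover B-forces «terminal, or a state of strictly smaller measure», then from every state the mover
B-forces terminal. -/
theorem DBWinsTo.wf_induction {P : MvPowerSeries (Fin (m + 1)) k × Decoration k m → Prop}
    (μ : MvPowerSeries (Fin (m + 1)) k × Decoration k m → Ordinal.{0})
    (h : ∀ σ, DBWinsTo (fun τ => P τ ∨ μ τ < μ σ) σ) : ∀ σ, DBWinsTo P σ := by
  intro σ
  induction hμ : μ σ using WellFoundedLT.induction generalizing σ with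
  | ind α ih =>
    subst hμ
    exact (h σ).bind fun τ hτ => hτ.elim DBWinsTo.of_target fun hlt => ih (μ τ) hlt τ rfl

end TameFourTupleDrop

end Summit.ResolutionOfSingularities.ResolutionOfSingularities.Theorems

end
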